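import Literature.NumberTheory.Transcendental.DerivationExtension
import Mathlib.RingTheory.Kaehler.Polynomial
import Mathlib.RingTheory.Kaehler.TensorProduct
import Mathlib.LinearAlgebra.TensorProduct.Prod
import Mathlib.LinearAlgebra.TensorProduct.Finiteness
import Mathlib.RingTheory.TensorProduct.Free
import Mathlib.RingTheory.FiniteType
import Mathlib.RingTheory.FinitePresentation
import Mathlib.Algebra.Module.FinitePresentation
import HarnessLib

/-!
# Absolute Kähler differentials of a finite-type algebra over a field: finitely presented ⊕ free

Route `ResolutionOfSingularities/RadicialJung`, crux `CleanModels` (stmt-ResolutionOfSingularities-15917),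
line `via-clean-models` of crux `DescentPerfectToAll` (stmt-ResolutionOfSingularities-0549): brick
K3b of the dimension-2 programme over an ARBITRARY ground field (PROGRAMME-clean-dim2). Helper file
(`--supports`), OURS; nothing here is a statement of Hironaka's manuscript.

Over a field `k` of characteristic `p` which is NOT `F`-finite, the module of ABSOLUTE differentials
`Ω_{A/𝔽_p}` (equivalently `Ω_{A/ℤ}`, or `Ω_{A/R}` for any base `R → k`) of a finitely generated
`k`-algebra `A` is not finitely generated: it contains `A ⊗_k Ω_{k/𝔽_p}`, free of rank `[k : k^p]`-many
(`p`-basis of `k`). Giraud's theory of the normal form of a function (Bull. SMF 111 (1983)), which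
the crux needs over arbitrary fields, is phrased through the coefficient ideal of `df` in `Ω¹`; to run
it without `F`-finiteness one needs that only FINITELY MANY directions of `Ω_{k/𝔽_p}` interact with
the finitely many equations of `A` ("tracking `p`-bases"). This file proves the structural form of that
remark:

* `exists_linearEquiv_kaehler_prod_of_formallySmooth` — for algebras `R → S → T` with `T` formally
  smooth over `S`: `Ω[T⁄R] ≃ (T ⊗[S] Ω[S⁄R]) × Ω[T⁄S]` (the first fundamental sequence is split
  exact: injective on the left by Jacobi–Zariski, `H₁(L_{T/S}) = 0`, and split because `Ω[T⁄S]` is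
  projective), compatibly with `mapBaseChange` and `map`;
* `exists_linearEquiv_kaehler_prod_finsupp_of_finiteType` — **for `A` of finite type over a field
  `k` and any base ring `R → k`: `Ω[A⁄R] ≃ M₀ × (ι →₀ A)` with `M₀` a FINITELY PRESENTED `A`-module**
  (write `A = k[X₁..X_n]/I`; `Ω[k[X]⁄R] ≃ (k[X] ⊗_k Ω[k⁄R]) × Ω[k[X]⁄k]`; the conormal presentation
  `Ω[A⁄R] = (A ⊗ Ω[k[X]⁄R]) / (I/I²)` has finitely generated relations, which live in
  `(A ⊗_k W) × A^n` for a finite-dimensional `W ⊆ Ω[k⁄R]`; a complement `W'` of `W` splits off the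
  free module `A ⊗_k W'`).

Consequence used downstream (closedness of Giraud's `E(f)`, local freeness of `Ω_{V/𝔽_p}` on the
regular locus): at a prime where `Ω[A_𝔭⁄R]` is projective, `M₀` is free near `𝔭`, hence so is
`Ω[A⁄R]`.

## References
* A. Grothendieck, EGA 0_IV (1964), 20.5.7, 20.5.12 (first fundamental sequence, polynomial
  algebras). [EGA0IV]
* J. Giraud, *Forme normale d'une fonction sur une surface de caractéristique positive*, Bull. Soc.
  Math. France 111 (1983), 1.1. [Giraud1983]
-/

noncomputable section

set_option linter.dupNamespace false -- mandated namespace of this single-conjunct summit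

open TensorProduct KaehlerDifferential Module

namespace Summit.ResolutionOfSingularities.ResolutionOfSingularities.Theorems.RadicialJung.CleanModels

universe u

/-! ## The split first fundamental sequence for a formally smooth algebra -/

/-- **Split first fundamental exact sequence.** For algebras `R → S → T` with `T` formally smooth
over `S`, there is a `T`-linear isomorphism `e : Ω[T⁄R] ≃ (T ⊗[S] Ω[S⁄R]) × Ω[T⁄S]` with
`e (mapBaseChange x) = (x, 0)` and second component the canonical map `Ω[T⁄R] → Ω[T⁄S]`: the
sequence `T ⊗ Ω[S⁄R] → Ω[T⁄R] → Ω[T⁄S] → 0` is exact (Mathlib), injective on the left since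
`H₁(L_{T/S}) = 0` (Jacobi–Zariski, `mapBaseChange_injective_of_formallySmooth`), and splits because
`Ω[T⁄S]` is projective. [cite: EGA0IV, Thm. 20.5.7] -/
theorem exists_linearEquiv_kaehler_prod_of_formallySmooth (R S T : Type*) [CommRing R]
    [CommRing S] [CommRing T] [Algebra R S] [Algebra R T] [Algebra S T] [IsScalarTower R S T]
    [Algebra.FormallySmooth S T] :
    ∃ e : Ω[T⁄R] ≃ₗ[T] (T ⊗[S] Ω[S⁄R]) × Ω[T⁄S],
      (∀ x, e (mapBaseChange R S T x) = (x, 0)) ∧ ∀ ω, (e ω).2 = map R S T T ω := by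
  have hinj := Literature.NumberTheory.Transcendental.mapBaseChange_injective_of_formallySmooth R S T
  have hex := KaehlerDifferential.exact_mapBaseChange_map R S T
  have hsurj : Function.Surjective (map R S T T) := KaehlerDifferential.map_surjective R S T
  obtain ⟨σ, hσ⟩ := Module.projective_lifting_property (map R S T T) LinearMap.id hsurj
  have hσ' : ∀ b, map R S T T (σ b) = b := fun b => by
    have := LinearMap.congr_fun hσ b
    rwa [LinearMap.comp_apply, LinearMap.id_apply] at this
  let g : (T ⊗[S] Ω[S⁄R]) × Ω[T⁄S] →ₗ[T] Ω[T⁄R] := (mapBaseChange R S T).coprod σ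
  have hg : ∀ a b, g (a, b) = mapBaseChange R S T a + σ b := fun a b => by
    simp [g, LinearMap.coprod_apply]
  have hg_inj : Function.Injective g := by
    rw [injective_iff_map_eq_zero]
    rintro ⟨a, b⟩ hab
    rw [hg] at hab
    have hb : b = 0 := by
      have := congrArg (map R S T T) hab
      rwa [map_add, hex.apply_apply_eq_zero, zero_add, map_zero, hσ'] at this
    subst hb
    rw [map_zero, add_zero] at hab
    rw [hinj (by rw [hab, map_zero] : mapBaseChange R S T a = mapBaseChange R S T 0)]
    rfl
  have hg_surj : Function.Surjective g := by
    intro ω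
    have hk : map R S T T (ω - σ (map R S T T ω)) = 0 := by
      rw [map_sub, hσ', sub_self]
    obtain ⟨a, ha⟩ := (hex _).mp hk
    refine ⟨(a, map R S T T ω), ?_⟩
    rw [hg, ha, sub_add_cancel]
  let e := (LinearEquiv.ofBijective g ⟨hg_inj, hg_surj⟩).symm
  have he : ∀ a b, e (mapBaseChange R S T a + σ b) = (a, b) := fun a b => by
    apply (LinearEquiv.ofBijective g ⟨hg_inj, hg_surj⟩).injective
    rw [LinearEquiv.apply_symm_apply, LinearEquiv.ofBijective_apply, hg]
  refine ⟨e, fun x => ?_, fun ω => ?_⟩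
  · have := he x 0
    rwa [map_zero, add_zero] at this
  · obtain ⟨⟨a, b⟩, rfl⟩ := hg_surj ω
    rw [hg, he, map_add, hex.apply_apply_eq_zero, zero_add, hσ']

/-- For a polynomial algebra `P = k[X_σ]` over an `R`-algebra `k`:
`Ω[P⁄R] ≃ (P ⊗[k] Ω[k⁄R]) × (σ →₀ P)` (`Ω[P⁄k]` is free on the `dX_i`).
[cite: EGA0IV, Cor. 20.5.12] -/
theorem exists_linearEquiv_kaehler_mvPolynomial (R k : Type*) (σ : Type*) [CommRing R] [CommRing k]
    [Algebra R k] :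
    ∃ e : Ω[MvPolynomial σ k⁄R] ≃ₗ[MvPolynomial σ k]
        (MvPolynomial σ k ⊗[k] Ω[k⁄R]) × (σ →₀ MvPolynomial σ k),
      ∀ x, e (mapBaseChange R k (MvPolynomial σ k) x) = (x, 0) := by
  obtain ⟨e, he, -⟩ := exists_linearEquiv_kaehler_prod_of_formallySmooth R k (MvPolynomial σ k)
  exact ⟨e ≪≫ₗ LinearEquiv.prodCongr (LinearEquiv.refl _ _) (mvPolynomialBasis k σ).repr,
    fun x => by simp [he]⟩

/-! ## Linear-algebra helpers -/

/-- Generators over the smaller ring of a scalar tower generate over the larger one. [folklore] -/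
theorem fg_of_fg_restrictScalars {S A M : Type*} [CommRing S] [CommRing A] [Algebra S A]
    [AddCommGroup M] [Module S M] [Module A M] [IsScalarTower S A M] (N : Submodule A M)
    (h : (N.restrictScalars S).FG) : N.FG := by
  obtain ⟨s, hs⟩ := h
  refine ⟨s, le_antisymm ?_ ?_⟩
  · rw [Submodule.span_le]
    intro x hx
    have : x ∈ N.restrictScalars S := hs ▸ Submodule.subset_span hx
    exact this
  · intro x hx
    have hx' : x ∈ Submodule.span S (s : Set M) := hs.symm ▸ hx
    exact Submodule.span_le_restrictScalars S A (s : Set M) hx'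

/-- The quotient of `X × Y` by a submodule of `X × 0` is `(X / K₀) × Y`, `K₀` the projection of the
submodule to `X`. [folklore] -/
theorem exists_linearEquiv_quotient_prod {A X Y : Type*} [CommRing A] [AddCommGroup X] [Module A X]
    [AddCommGroup Y] [Module A Y] (K : Submodule A (X × Y)) (hK : ∀ z ∈ K, z.2 = 0) :
    Nonempty (((X × Y) ⧸ K) ≃ₗ[A] (X ⧸ K.map (LinearMap.fst A X Y)) × Y) := by
  let K₀ := K.map (LinearMap.fst A X Y)
  let f : X × Y →ₗ[A] (X ⧸ K₀) × Y := (K₀.mkQ).prodMap LinearMap.id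
  have hf : Function.Surjective f := fun ⟨q, y⟩ => by
    obtain ⟨x, rfl⟩ := K₀.mkQ_surjective q
    exact ⟨(x, y), rfl⟩
  have hker : LinearMap.ker f = K := by
    rw [LinearMap.ker_prodMap, Submodule.ker_mkQ, LinearMap.ker_id]
    ext ⟨x, y⟩
    simp only [Submodule.mem_prod, Submodule.mem_bot]
    constructor
    · rintro ⟨hx, rfl⟩
      obtain ⟨⟨x', y'⟩, hxy, rfl⟩ := hx
      have hy' : y' = 0 := hK _ hxy
      subst hy'
      exact hxy
    · intro hxy
      exact ⟨⟨(x, y), hxy, rfl⟩, hK _ hxy⟩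
  exact ⟨(Submodule.quotEquivOfEq _ _ hker.symm) ≪≫ₗ f.quotKerEquivOfSurjective hf⟩

/-! ## Finite-type algebras over a field -/

/-- **Absolute differentials of a finite-type algebra over a field are finitely presented up to a
free summand.** For a field `k`, a base ring `R → k` (e.g. `ℤ` or `𝔽_p`) and `A` of finite type
over `k`: `Ω[A⁄R] ≃ M₀ × (ι →₀ A)` for a finitely presented `A`-module `M₀` and some index type `ι`.
Proof: `A = P/I`, `P = k[X₁, …, X_n]`; `Ω[A⁄R] = (A ⊗_P Ω[P⁄R]) / (I/I²)` (conormal sequence) with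
finitely generated relations (`P` Noetherian); `A ⊗_P Ω[P⁄R] ≃ (A ⊗_k Ω[k⁄R]) × A^n`
(`exists_linearEquiv_kaehler_mvPolynomial`); the relations involve a finite-dimensional
`W ⊆ Ω[k⁄R]`, and a complement `W'` of `W` contributes the free summand `A ⊗_k W'`.
[cite: EGA0IV, Thm. 20.5.7, Cor. 20.5.12] -/
theorem exists_linearEquiv_kaehler_prod_finsupp_of_finiteType (R k A : Type u) [CommRing R]
    [Field k] [CommRing A] [Algebra R k] [Algebra R A] [Algebra k A] [IsScalarTower R k A]
    [Algebra.FiniteType k A] :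
    ∃ (M₀ : Type u) (_ : AddCommGroup M₀) (_ : Module A M₀) (_ : Module.FinitePresentation A M₀)
      (ι : Type u), Nonempty (Ω[A⁄R] ≃ₗ[A] M₀ × (ι →₀ A)) := by
  classical
  obtain ⟨n, φ, hφ⟩ :=
    Algebra.FiniteType.iff_quotient_mvPolynomial''.mp ‹Algebra.FiniteType k A›
  let P := MvPolynomial (Fin n) k
  letI : Algebra P A := φ.toRingHom.toAlgebra
  haveI : IsScalarTower k P A := IsScalarTower.of_algebraMap_eq fun c => (φ.commutes c).symm
  haveI : IsScalarTower R P A := IsScalarTower.of_algebraMap_eq fun r => by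
    rw [IsScalarTower.algebraMap_apply R k P, IsScalarTower.algebraMap_apply R k A]
    exact (φ.commutes _).symm
  have hPA : Function.Surjective (algebraMap P A) := hφ
  -- (1) the conormal presentation `Ω[A⁄R] = (A ⊗_P Ω[P⁄R]) / K`, `K` finitely generated
  let K : Submodule A (A ⊗[P] Ω[P⁄R]) := LinearMap.ker (mapBaseChange R P A)
  have eΩ : ((A ⊗[P] Ω[P⁄R]) ⧸ K) ≃ₗ[A] Ω[A⁄R] :=
    (mapBaseChange R P A).quotKerEquivOfSurjective (mapBaseChange_surjective R P A hPA)
  have hKfg : K.FG := by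
    apply fg_of_fg_restrictScalars (S := P)
    rw [← KaehlerDifferential.range_kerCotangentToTensor R P A hPA, LinearMap.range_eq_map]
    haveI : IsNoetherianRing P := MvPolynomial.isNoetherianRing
    let I := RingHom.ker (algebraMap P A)
    haveI : Module.Finite P I := Module.IsNoetherian.finite P I
    haveI : Module.Finite P I.Cotangent :=
      Module.Finite.of_surjective I.toCotangent I.toCotangent_surjective
    exact Module.Finite.fg_top.map _
  -- (2) `A ⊗_P Ω[P⁄R] ≃ (A ⊗_k V) × A^n`, `V = Ω[k⁄R]`
  obtain ⟨e₁, -⟩ := exists_linearEquiv_kaehler_mvPolynomial R k (Fin n)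
  let V := Ω[k⁄R]
  let F := Fin n →₀ A
  let eG : A ⊗[P] Ω[P⁄R] ≃ₗ[A] (A ⊗[k] V) × F :=
    LinearEquiv.baseChange P A _ _ e₁ ≪≫ₗ TensorProduct.prodRight P A A (P ⊗[k] V) (Fin n →₀ P) ≪≫ₗ
      LinearEquiv.prodCongr (AlgebraTensorModule.cancelBaseChange k P A A V)
        (Algebra.TensorProduct.basis A
          (Finsupp.basisSingleOne : Basis (Fin n) P (Fin n →₀ P))).repr
  let K' : Submodule A ((A ⊗[k] V) × F) := K.map (eG : A ⊗[P] Ω[P⁄R] →ₗ[A] (A ⊗[k] V) × F)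
  obtain ⟨s, hs⟩ : K'.FG := hKfg.map _
  -- (3) the first components of the generators involve a finite-dimensional `W ⊆ V`
  obtain ⟨W, hWfin, hWs⟩ := TensorProduct.exists_finite_submodule_right_of_setFinite
    ((fun g : (A ⊗[k] V) × F => g.1) '' (s : Set ((A ⊗[k] V) × F))) (s.finite_toSet.image _)
  haveI := hWfin
  obtain ⟨W', hWW'⟩ := W.exists_isCompl
  let eV : (W × W') ≃ₗ[k] V := Submodule.prodEquivOfIsCompl W W' hWW'
  let eAV : A ⊗[k] V ≃ₗ[A] (A ⊗[k] W) × (A ⊗[k] W') :=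
    LinearEquiv.baseChange k A _ _ eV.symm ≪≫ₗ TensorProduct.prodRight k A A W W'
  have heAV : ∀ y : A ⊗[k] W, (eAV (W.subtype.lTensor A y)).2 = 0 := by
    intro y
    induction y with
    | zero => simp
    | tmul a w =>
      simp [eAV, eV, LinearEquiv.baseChange_tmul]
    | add y z hy hz => rw [map_add, map_add, Prod.snd_add, hy, hz, add_zero]
  -- (4) rearrange to `X × Y`, `X = (A ⊗ W) × A^n` finite free, `Y = A ⊗ W'`
  let X := (A ⊗[k] W) × F
  let Y := A ⊗[k] W'
  let sh : (((A ⊗[k] W) × (A ⊗[k] W')) × F) ≃ₗ[A] (X × Y) :=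
    { toFun := fun z => ((z.1.1, z.2), z.1.2)
      invFun := fun z => ((z.1.1, z.2), z.1.2)
      map_add' := fun _ _ => rfl
      map_smul' := fun _ _ => rfl
      left_inv := fun _ => rfl
      right_inv := fun _ => rfl }
  let eT : ((A ⊗[k] V) × F) ≃ₗ[A] (X × Y) := LinearEquiv.prodCongr eAV (LinearEquiv.refl A F) ≪≫ₗ sh
  let K'' : Submodule A (X × Y) := K'.map (eT : (A ⊗[k] V) × F →ₗ[A] X × Y)
  have hK'' : ∀ z ∈ K'', z.2 = 0 := by
    have hle : K'' ≤ LinearMap.ker (LinearMap.snd A X Y) := by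
      change K'.map (eT : (A ⊗[k] V) × F →ₗ[A] X × Y) ≤ _
      rw [← hs, Submodule.map_span, Submodule.span_le]
      rintro _ ⟨g, hg, rfl⟩
      obtain ⟨y, hy⟩ := hWs ⟨g, hg, rfl⟩
      rw [SetLike.mem_coe, LinearMap.mem_ker, LinearMap.snd_apply]
      change (eAV g.1).2 = 0
      have hy' : W.subtype.lTensor A y = g.1 := hy
      rw [← hy']
      exact heAV y
    intro z hz
    exact hle hz
  obtain ⟨eQ⟩ := exists_linearEquiv_quotient_prod K'' hK''
  -- (5) assemble
  let K₀ := K''.map (LinearMap.fst A X Y)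
  have hK₀fg : K₀.FG := ((hKfg.map _).map _).map _
  haveI : Module.FinitePresentation k W := Module.finitePresentation_of_finite k W
  haveI : Module.FinitePresentation A X := inferInstance
  haveI : Module.FinitePresentation A (X ⧸ K₀) :=
    Module.finitePresentation_of_surjective K₀.mkQ K₀.mkQ_surjective (by rwa [Submodule.ker_mkQ])
  let eY : Y ≃ₗ[A] (Module.Free.ChooseBasisIndex k W' →₀ A) :=
    (Algebra.TensorProduct.basis A (Module.Free.chooseBasis k W')).repr
  refine ⟨X ⧸ K₀, inferInstance, inferInstance, inferInstance, Module.Free.ChooseBasisIndex k W', ⟨?_⟩⟩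
  exact eΩ.symm ≪≫ₗ Submodule.Quotient.equiv K K' eG rfl ≪≫ₗ Submodule.Quotient.equiv K' K'' eT rfl ≪≫ₗ
    eQ ≪≫ₗ LinearEquiv.prodCongr (LinearEquiv.refl A _) eY

end Summit.ResolutionOfSingularities.ResolutionOfSingularities.Theorems.RadicialJung.CleanModels

end
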